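import Summits.QuantumFields.YangMills.Theorems.ToronSmallBallOwnAxisShiftDefs
import Summits.QuantumFields.YangMills.Theorems.ToronSmallBallSiteTwistChain
import Summits.QuantumFields.YangMills.Theorems.QuantileBitPuritySU2ClassShiftCovariance
import Summits.QuantumFields.YangMills.Theorems.SwapTwistDeficitPolyakovHolonomy
import Literature.MathematicalPhysics.QuantumFieldTheory.ConstructiveQFTWave0WilsonLoopRPProofs
import HarnessLib

/-!
# The own-axis sheet shift: line holonomies, gauge covariance, measurability

Support module (`--supports` stmt-QuantumFields-24089, `ToronSmallBall.PeriodicOffCoreStripWindowDeep`; seat ym-dw-p1 g15, LINE g12-A of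
ym-idea-4).  For the own-axis sheet shift `ownShift θ U = siteTwist 0 (ownAxisField θ U) U` (defs module `ToronSmallBallOwnAxisShiftDefs`)
on the spatial torus `(ℤ/L)³` with `SU(2)` links we prove the bookkeeping identities used by the Jacobian and cost modules:

* §1 line holonomies: `lineHolonomy U 0 L x = U(x,0) · R_x(U)` with the REST `R_x(U) = lineHolonomy U 0 (L−1) (x+e₀)` independent of every
  plane link (`lineRest_siteTwist`, `lineRest_update`); a sheet translate multiplies the holonomy of a plane line by its element
  (`lineHolonomy_siteTwist_zero`), a one-link update on ANOTHER plane line does nothing (`lineHolonomy_update_of_ne`); hence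
  ★ `lineHolonomy_ownShift : lineHolonomy (ownShift θ U) 0 L x = classShift θ (lineHolonomy U 0 L x)` for plane sites `x`,
  `polyX_ownShift : polyX (ownShift θ U) = classShift θ (polyX U)`, and the `y`-holonomy through the origin is untouched
  (`polDist_swap_ownShift`);
* §2 gauge covariance WITHOUT an external axis field: `ownAxisField θ (U^g) x = g(x) · ownAxisField θ U x · g(x)⁻¹` and
  ★ `ownShift_gaugeTransform : ownShift θ (U^g) = (ownShift θ U)^g` (the axis of `g P g⁻¹` is the rotated axis, `ClassShift.classShift_conj`);
* §3 measurability of `U ↦ lineHolonomy U k n y`, `ownAxisField θ`, `ownShift θ`, and of configuration-dependent sheet translates.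

HONEST FRAMING: fixed-lattice bookkeeping; no estimate; nothing about infinite volume, the continuum limit or the Clay gap.  No `sorry`, no new
axiom, no new definition.  References: [cite: Luscher1983, §2]; [cite: tHooft1979].
-/

set_option autoImplicit false

noncomputable section

open MeasureTheory Function
open Literature.MathematicalPhysics.QuantumFieldTheory
open Literature.MathematicalPhysics.QuantumLattice
open Literature.MathematicalPhysics.QuantumFieldTheory.Balaban1983to89.T4HaarSU2ExpChart (expPoint measurable_expPoint)

namespace Summit.QuantumFields.YangMills.Theorems.FemtoTransferGap

variable {L : ℕ}


namespace OwnAxis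

open ClassShift

/-! ## §1 Line holonomies of the `x`-lines -/

section Holonomy

variable {G : Type*} [Group G]

/-- The `0`-coordinate of the `s`-th site after the plane site `x` (`x₀ = 0`) along `e₀` is `1 + s`. [folklore] -/
theorem shift_add_single_apply_zero {x : Site 3 L} (hx : x 0 = 0) (s : ℕ) :
    (x.shift 0 + Pi.single (0 : Fin 3) ((s : ℕ) : ZMod L) : Site 3 L) 0 = (((1 + s : ℕ)) : ZMod L) := by
  simp [Site.shift, hx]

/-- For `s < L − 1` the site `x + (1+s)e₀` behind a plane site `x` is OFF the plane `x₀ = 0`. [folklore] -/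
theorem shift_add_single_apply_zero_ne {x : Site 3 L} (hx : x 0 = 0) {s : ℕ} (hs : s < L - 1) :
    (x.shift 0 + Pi.single (0 : Fin 3) ((s : ℕ) : ZMod L) : Site 3 L) 0 ≠ 0 := by
  rw [shift_add_single_apply_zero hx, Ne, ZMod.natCast_eq_zero_iff]
  intro h
  have := Nat.le_of_dvd (by omega) h
  omega

/-- **The rest of a plane line does not see the plane links**: if `U` and `V` agree off the sheet `{(y,0) : y₀ = 0}`, then
`lineHolonomy U 0 (L−1) (x+e₀) = lineHolonomy V 0 (L−1) (x+e₀)` for every plane site `x`. [folklore] -/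
theorem lineRest_congr {U V : GaugeConfig 3 L G} (h : ∀ e : Edge 3 L, ¬ (e.2 = 0 ∧ e.1 0 = 0) → U e = V e) {x : Site 3 L} (hx : x 0 = 0) :
    lineHolonomy U 0 (L - 1) (x.shift 0) = lineHolonomy V 0 (L - 1) (x.shift 0) :=
  WilsonLoopRP.lineHolonomy_congr 0 (L - 1) (x.shift 0) fun _ hs => h _ fun hc => shift_add_single_apply_zero_ne hx hs hc.2

/-- The rest of a plane line is unchanged by any sheet translate through `x₀ = 0`. [folklore] -/
theorem lineRest_siteTwist (h : Site 3 L → G) (U : GaugeConfig 3 L G) {x : Site 3 L} (hx : x 0 = 0) :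
    lineHolonomy (siteTwist 0 h U) 0 (L - 1) (x.shift 0) = lineHolonomy U 0 (L - 1) (x.shift 0) :=
  lineRest_congr (fun e he => by rw [siteTwist_apply, if_neg he]) hx

/-- The rest of a plane line is unchanged by updating a plane link. [folklore] -/
theorem lineRest_update [DecidableEq (Edge 3 L)] (U : GaugeConfig 3 L G) {y : Site 3 L} (hy : y 0 = 0) (W : G) {x : Site 3 L} (hx : x 0 = 0) :
    lineHolonomy (update U (y, 0) W) 0 (L - 1) (x.shift 0) = lineHolonomy U 0 (L - 1) (x.shift 0) :=
  lineRest_congr (fun e he => by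
    rw [update_of_ne]
    rintro rfl
    exact he ⟨rfl, hy⟩) hx

variable [NeZero L]

/-- ★ `lineHolonomy U 0 L x = U(x,0) · lineHolonomy U 0 (L−1) (x+e₀)` — plane link first, then the rest. [folklore] -/
theorem lineHolonomy_eq_mul_rest (U : GaugeConfig 3 L G) (x : Site 3 L) :
    lineHolonomy U 0 L x = U (x, 0) * lineHolonomy U 0 (L - 1) (x.shift 0) := by
  -- (the general first-step recursion is `GaugeBoot.DiagRPSUN.lineHolonomy_eq_mul`; two lines keep that import out)
  obtain ⟨n, hn⟩ := Nat.exists_eq_succ_of_ne_zero (NeZero.ne L)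
  have h : ∀ m : ℕ, m = n + 1 → lineHolonomy U 0 m x = U (x, 0) * lineHolonomy U 0 (m - 1) (x.shift 0) := fun m hm => by subst hm; rfl
  exact h L hn

/-- **A sheet translate multiplies the holonomy of each plane line by its element**: `P(siteTwist₀^h U, x) = h(x) · P(U, x)` for `x₀ = 0`.
[cite: tHooft1979] -/
theorem lineHolonomy_siteTwist_zero (h : Site 3 L → G) (U : GaugeConfig 3 L G) {x : Site 3 L} (hx : x 0 = 0) :
    lineHolonomy (siteTwist 0 h U) 0 L x = h x * lineHolonomy U 0 L x := by
  rw [lineHolonomy_eq_mul_rest, lineHolonomy_eq_mul_rest, lineRest_siteTwist h U hx, siteTwist_apply, if_pos ⟨rfl, hx⟩, mul_assoc]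

/-- Updating the plane link of ANOTHER plane line does not change the holonomy of the line through `x`. [folklore] -/
theorem lineHolonomy_update_of_ne [DecidableEq (Edge 3 L)] (U : GaugeConfig 3 L G) {x y : Site 3 L} (hx : x 0 = 0) (hy : y 0 = 0)
    (hxy : x ≠ y) (W : G) : lineHolonomy (update U (y, 0) W) 0 L x = lineHolonomy U 0 L x := by
  rw [lineHolonomy_eq_mul_rest, lineHolonomy_eq_mul_rest, lineRest_update U hy W hx, update_of_ne]
  exact fun h => hxy (congrArg Prod.fst h)

/-- Updating the plane link of the line through `x` by `W`: the holonomy becomes `W · rest`. [folklore] -/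
theorem lineHolonomy_update_self [DecidableEq (Edge 3 L)] (U : GaugeConfig 3 L G) {x : Site 3 L} (hx : x 0 = 0) (W : G) :
    lineHolonomy (update U (x, 0) W) 0 L x = W * lineHolonomy U 0 (L - 1) (x.shift 0) := by
  rw [lineHolonomy_eq_mul_rest, lineRest_update U hx W hx, update_self]

omit [NeZero L] in
/-- **Gauge covariance of an open line**: `P_m(U^g, y) = g(y) · P_m(U, y) · g(y + m e_k)⁻¹`. [folklore] -/
theorem lineHolonomy_gaugeTransform (g : Site 3 L → G) (U : GaugeConfig 3 L G) (k : Fin 3) :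
    ∀ (m : ℕ) (y : Site 3 L), lineHolonomy (gaugeTransform g U) k m y =
      g y * lineHolonomy U k m y * (g (y + Pi.single k ((m : ℕ) : ZMod L)))⁻¹
  | 0, y => by simp [lineHolonomy]
  | m + 1, y => by
    rw [lineHolonomy, lineHolonomy, lineHolonomy_gaugeTransform g U k m (y.shift k), WilsonLoopRP.shift_add_single]
    simp only [gaugeTransform]
    group

omit [NeZero L] in
/-- A CLOSED line (`m = L`) is conjugated by the gauge transformation at its base point. [cite: Luscher1983, §2] -/
theorem lineHolonomy_gaugeTransform_closed (g : Site 3 L → G) (U : GaugeConfig 3 L G) (k : Fin 3) (y : Site 3 L) :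
    lineHolonomy (gaugeTransform g U) k L y = g y * lineHolonomy U k L y * (g y)⁻¹ := by
  rw [lineHolonomy_gaugeTransform, ZMod.natCast_self, Pi.single_zero, add_zero]

end Holonomy

/-! ## §1b The own-axis shift on line holonomies -/

section Own

variable [NeZero L]

/-- ★ **Every plane line holonomy is shifted along its own axis**: `P(ownShift θ U, x) = classShift θ (P(U, x))` for `x₀ = 0`.
[cite: Luscher1983, §2] -/
theorem lineHolonomy_ownShift (θ : ℝ) (U : GaugeConfig 3 L SU2) {x : Site 3 L} (hx : x 0 = 0) :
    lineHolonomy (ownShift θ U) 0 L x = classShift θ (lineHolonomy U 0 L x) := by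
  rw [ownShift_def, lineHolonomy_siteTwist_zero _ U hx, ownAxisField_apply, classShift_apply]

omit [NeZero L] in
/-- The `x`-Polyakov holonomy through the origin is the closed line holonomy based at `0`. [folklore] -/
theorem polyX_eq_lineHolonomy (U : GaugeConfig 3 L SU2) : FlatSheet.polyX U = lineHolonomy U 0 L 0 := by
  unfold FlatSheet.polyX
  suffices h : ∀ n : ℕ, FlatSheet.polyXAux U n = lineHolonomy U 0 n 0 from h L
  intro n
  induction n with
  | zero => rfl
  | succ n ih =>
    rw [FlatSheet.polyXAux_succ, WilsonLoopRP.lineHolonomy_succ_right, ih, zero_add]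
    rfl

/-- ★ `polyX (ownShift θ U) = classShift θ (polyX U)`: the holonomy through the origin moves along its own ray by `θ`. [cite: Luscher1983, §2] -/
theorem polyX_ownShift (θ : ℝ) (U : GaugeConfig 3 L SU2) : FlatSheet.polyX (ownShift θ U) = classShift θ (FlatSheet.polyX U) := by
  rw [ownShift_def, polyX_siteTwist_zero, ownAxisField_apply, ← polyX_eq_lineHolonomy, classShift_apply]

omit [NeZero L] in
/-- The `y`-holonomy through the origin does not see the own-axis `x`-sheet shift. [cite: Luscher1983, §2] -/
theorem polDist_swap_ownShift (θ : ℝ) (U : GaugeConfig 3 L SU2) :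
    FlatSheet.polDist (configPerm (Equiv.swap (0 : Fin 3) 1) (ownShift θ U)) = FlatSheet.polDist (configPerm (Equiv.swap (0 : Fin 3) 1) U) := by
  rw [ownShift_def, polDist_configPerm_swap_siteTwist_zero one_ne_zero]

omit [NeZero L] in
/-- Off the sheet nothing changes. [folklore] -/
theorem ownShift_apply_of_not (θ : ℝ) (U : GaugeConfig 3 L SU2) {e : Edge 3 L} (he : ¬ (e.2 = 0 ∧ e.1 0 = 0)) : ownShift θ U e = U e := by
  rw [ownShift_def, siteTwist_apply, if_neg he]

omit [NeZero L] in
/-- On the sheet: `(ownShift θ U)(x,0) = ownAxisField θ U x · U(x,0)`. [folklore] -/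
theorem ownShift_apply_sheet (θ : ℝ) (U : GaugeConfig 3 L SU2) {x : Site 3 L} (hx : x 0 = 0) :
    ownShift θ U (x, 0) = ownAxisField θ U x * U (x, 0) := by
  rw [ownShift_def, siteTwist_apply, if_pos ⟨rfl, hx⟩]

/-- On the sheet, in update form: `(ownShift θ U)(x,0) = classShift θ (U(x,0)·R_x U) · (R_x U)⁻¹`. [folklore] -/
theorem ownShift_apply_sheet' (θ : ℝ) (U : GaugeConfig 3 L SU2) {x : Site 3 L} (hx : x 0 = 0) :
    ownShift θ U (x, 0) = classShift θ (U (x, 0) * lineHolonomy U 0 (L - 1) (x.shift 0)) * (lineHolonomy U 0 (L - 1) (x.shift 0))⁻¹ := by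
  rw [ownShift_apply_sheet θ U hx, ownAxisField_apply, lineHolonomy_eq_mul_rest, classShift_apply, mul_assoc, mul_assoc, mul_inv_cancel, mul_one]

end Own

/-! ## §2 Gauge covariance -/

section Gauge

/-- The own-axis rotation of a conjugated element is the conjugated rotation: `exp(ι θ axis(gWg⁻¹)) = g · exp(ι θ axis W) · g⁻¹`.
[folklore] -/
theorem expPoint_axisVec_conj (θ : ℝ) (g W : SU2) :
    expPoint (θ • axisVec (g * W * g⁻¹)) = g * expPoint (θ • axisVec W) * g⁻¹ := by
  have h := classShift_conj θ g W
  rw [classShift_apply, classShift_apply] at h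
  have h2 : expPoint (θ • axisVec (g * W * g⁻¹)) = (g * (expPoint (θ • axisVec W) * W) * g⁻¹) * (g * W * g⁻¹)⁻¹ := by
    rw [← h, mul_inv_cancel_right]
  rw [h2]
  group

/-- ★ **The own-axis field of a gauge-transformed configuration is the conjugated field**: `ownAxisField θ (U^g) x = g(x) · ownAxisField θ U x · g(x)⁻¹`.
[cite: Luscher1983, §2] -/
theorem ownAxisField_gaugeTransform (θ : ℝ) (g : Site 3 L → SU2) (U : GaugeConfig 3 L SU2) (x : Site 3 L) :
    ownAxisField θ (gaugeTransform g U) x = g x * ownAxisField θ U x * (g x)⁻¹ := by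
  rw [ownAxisField_apply, ownAxisField_apply, lineHolonomy_gaugeTransform_closed, expPoint_axisVec_conj]

/-- ★ **Gauge covariance of the own-axis sheet shift**: `ownShift θ (U^g) = (ownShift θ U)^g` — no external axis field is needed.
[cite: Luscher1983, §2] [cite: tHooft1979] -/
theorem ownShift_gaugeTransform (θ : ℝ) (g : Site 3 L → SU2) (U : GaugeConfig 3 L SU2) :
    ownShift θ (gaugeTransform g U) = gaugeTransform g (ownShift θ U) := by
  rw [ownShift_def, ownShift_def, gaugeTransform_siteTwist]
  congr 1
  funext x
  rw [ownAxisField_gaugeTransform]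

end Gauge

/-! ## §3 Measurability -/

section Meas

/-- Line holonomies are measurable in the configuration. [folklore] -/
theorem measurable_lineHolonomy (k : Fin 3) : ∀ (n : ℕ) (y : Site 3 L), Measurable fun U : GaugeConfig 3 L SU2 => lineHolonomy U k n y
  | 0, _ => by simpa only [lineHolonomy] using measurable_const
  | n + 1, y => by
    simp only [lineHolonomy]
    exact (measurable_pi_apply _).mul (measurable_lineHolonomy k n _)

/-- The own-axis field is jointly measurable as a map `U ↦ (x ↦ ownAxisField θ U x)`. [folklore] -/
theorem measurable_ownAxisField (θ : ℝ) : Measurable fun U : GaugeConfig 3 L SU2 => ownAxisField θ U := by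
  refine measurable_pi_lambda _ fun x => ?_
  simp only [ownAxisField_apply]
  exact measurable_expPoint.comp ((measurable_axisVec.comp (measurable_lineHolonomy 0 L x)).const_smul θ)

/-- A sheet translate by a measurable configuration-DEPENDENT field is measurable. [folklore] -/
theorem measurable_siteTwist_of_measurable {hf : GaugeConfig 3 L SU2 → Site 3 L → SU2} (hm : Measurable hf) :
    Measurable fun U : GaugeConfig 3 L SU2 => siteTwist 0 (hf U) U :=
  (measurable_siteTwist_uncurry (G := SU2) (L := L) 0).comp (hm.prodMk measurable_id)

/-- The own-axis sheet shift is measurable. [folklore] -/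
theorem measurable_ownShift (θ : ℝ) : Measurable (ownShift (L := L) θ) := by
  have h := measurable_siteTwist_of_measurable (measurable_ownAxisField (L := L) θ)
  have e : (ownShift (L := L) θ) = fun U => siteTwist 0 (ownAxisField θ U) U := funext fun U => ownShift_def θ U
  rw [e]; exact h

end Meas

end OwnAxis

end Summit.QuantumFields.YangMills.Theorems.FemtoTransferGap

end
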